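import Summits.AtomisticToContinuum.Crystallization.Theorems.ChartedZeroExcessLayeredLatticeLiouvilleZZZYRCXRS
import Summits.AtomisticToContinuum.Crystallization.Theorems.ChartedZeroExcessLayeredLatticeLiouvilleZZZYRCXRM
import Summits.AtomisticToContinuum.Crystallization.Theorems.ChartedZeroExcessLayeredLatticeLiouvilleZZZYRCXN

/-!
# ChartedZeroExcessLayeredLatticeLiouville · ZZZYRCXRC — THE θ⁰ OUT-OF-WINDOW KERNEL: COMPLETENESS OF ONE Δm-BLOCK BY COUNTING (§8–§9)
(decomp-a2c hand-1 g55; target stmt-AtomisticToContinuum-26636 JS-D near reader, line (D) 5c θ_out; critic r1871 (D) A1, r1873 (B) «REMAINING: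
§7 countWinsO semantics + Δm-block pigeonhole (RCXM/RCXN pattern)»)

§8 letters and acceptance: `le_two_of_mem_trials`, `regO_le_two`, the decided side condition `farLayer ym cs` (every chord's far code has
shifted layer `ym`) + `farLayer_sound`, `foldO_accepted`/`slabAccO_accepted` (a successful out-slab accepted every chord),
`addChordO_witness` (acceptance ⇒ SOME trial far letter has a context), `octx_some_range` (a context ⇒ its `u9` is in `(lo, hi]`),
`inBoxγ_of_form_le` (RCXM's box lemma without the layer clause), `someInWindow_of_range`.
§9 ★★ `outBlock_complete`: an accepted out-slab with `farLayer ym`, strictly increasing far codes and exactly `countWinsO … ym` chords holds a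
chord to EVERY far index site `(y0, y1, ym)` whose chord from the base is in `(lo, hi]` under ANY admissible letter assignment `ρ` — the
pigeonhole on `boxPairs GB` (RCXRM `countWinsO_eq`/`u9O_eq`, RCXN `cover_of_card_le_map`): the (C) clause of lens-2's `KernelSlabSoundOut` in
kernel currency.  Imports RCXRS + RCXRM + RCXN; 0 sorry.  All `[folklore]`.
-/

namespace Summit.AtomisticToContinuum.Crystallization.Theorems.ChartedZeroExcessLayeredLatticeLiouville.ThetaKernel

/-! ## §8 small facts about the program's letters and acceptance -/

/-- a trial letter is at most `2`. [folklore] -/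
theorem le_two_of_mem_trials {b : Bool} {rY : ℕ} (h : rY ∈ trials b) : rY ≤ 2 := by
  unfold trials at h
  cases b <;> simp at h <;> omega

/-- the letter lookup returns a letter `≤ 2` when the window letters and the three trial letters are. [folklore] -/
theorem regO_le_two {win : List ℕ} (hwin : ∀ n ∈ win, n ≤ 2) {wlo whi amY rY amA ra rb : ℕ} (hrY : rY ≤ 2) (hra : ra ≤ 2)
    (hrb : rb ≤ 2) (am : ℕ) : regO win wlo whi amY rY amA ra rb am ≤ 2 := by
  have hg : win.getD (am - wlo) 0 ≤ 2 := by
    rw [List.getD_eq_getElem?_getD]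
    rcases hj : (getElem? win (am - wlo) : Option ℕ) with _ | y
    · simp
    · exact hwin y (List.mem_of_getElem? hj)
  unfold regO
  cases inWin wlo whi am <;> cases Nat.beq am amY <;> cases Nat.beq am amA <;> simpa

/-- DECIDED SIDE CONDITION of an out-slab: every chord's far code has shifted layer `ym` (the slab is ONE Δm-block). -/
def farLayer (ym : ℕ) (cs : List (List ℕ)) : Bool := cs.all fun c => Nat.beq (lastD c 0 % 1201) ym

/-- soundness of `farLayer`. [folklore] -/
theorem farLayer_sound {ym : ℕ} {cs : List (List ℕ)} (h : farLayer ym cs = true) : ∀ c ∈ cs, lastD c 0 % 1201 = ym := by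
  intro c hc
  unfold farLayer at h
  have := List.all_eq_true.mp h c hc
  exact Nat.eq_of_beq_eq_true this

/-- a successful out-fold accepted every chord. [folklore] -/
theorem foldO_accepted {win : List ℕ} {wlo whi amX P9 AE : ℕ} {lo hi : ℤ} : ∀ (cs : List (List ℕ)) (t t' : PT),
    cs.foldl (fun acc c => match acc with | none => none | some t => addChordO win wlo whi amX P9 AE lo hi c t) (some t) = some t' →
    ∀ c ∈ cs, ∃ u u', addChordO win wlo whi amX P9 AE lo hi c u = some u'
  | [], _, _, _, c, hc => by simp at hc
  | c :: rest, t, t', h, d, hd => by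
    simp only [List.foldl_cons] at h
    have hnone : ∀ l : List (List ℕ),
        l.foldl (fun acc c => match acc with | none => none | some t => addChordO win wlo whi amX P9 AE lo hi c t) none = none :=
      fun l => by
        induction l with
        | nil => rfl
        | cons _ _ ih => exact ih
    cases hc : addChordO win wlo whi amX P9 AE lo hi c t with
    | none => rw [hc, hnone] at h; exact absurd h (by simp)
    | some t₁ =>
      rw [hc] at h
      rcases List.mem_cons.mp hd with rfl | hd
      · exact ⟨t, t₁, hc⟩
      · exact foldO_accepted rest t₁ t' h d hd

/-- a successful out-slab accepted every chord. [folklore] -/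
theorem slabAccO_accepted {win : List ℕ} {wlo whi amX P9 E : ℕ} {lo hi : ℤ} {t0 : PT} {cs : List (List ℕ)} {T : List (ℕ × ℕ × ℕ)}
    (h : slabAccO win wlo whi amX P9 E lo hi t0 cs = some T) :
    ∀ c ∈ cs, ∃ u u', addChordO win wlo whi amX P9 (2 ^ E * 45927) lo hi c u = some u' := by
  unfold slabAccO at h
  simp only [Option.map_eq_some_iff] at h
  obtain ⟨t', ht', -⟩ := h
  exact foldO_accepted cs t0 t' ht'

/-- an accepted out-chord has SOME trial far letter whose context exists (its `u9` is in the window). [folklore] -/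
theorem addChordO_witness {win : List ℕ} {wlo whi amX P9 AE : ℕ} {lo hi : ℤ} {c : List ℕ} {t t' : PT}
    (h : addChordO win wlo whi amX P9 AE lo hi c t = some t') :
    ∃ rY ∈ trials (!(inWin wlo whi (lastD c 0 % 1201))), ∃ κ,
      octx win wlo whi amX AE c.length (lastD c 0 / 1442401) (lastD c 0 / 1201 % 1201) (lastD c 0 % 1201) lo hi rY = some κ := by
  rw [addChordO_eq] at h
  simp only at h
  set ctxs := (trials (!(inWin wlo whi (lastD c 0 % 1201)))).filterMap
    (octx win wlo whi amX AE c.length (lastD c 0 / 1442401) (lastD c 0 / 1201 % 1201) (lastD c 0 % 1201) lo hi) with hctxs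
  by_cases he : ctxs = []
  · rw [he] at h; simp at h
  · obtain ⟨κ, hκ⟩ := List.exists_mem_of_ne_nil ctxs he
    rw [hctxs, List.mem_filterMap] at hκ
    obtain ⟨rY, hrY, hoc⟩ := hκ
    exact ⟨rY, hrY, κ, hoc⟩

/-- an existing context has its `u9` in the window `(lo, hi]`. [folklore] -/
theorem octx_some_range {win : List ℕ} {wlo whi amX AE n y0 y1 ym : ℕ} {lo hi : ℤ} {rY : ℕ} {κ : OCtx}
    (h : octx win wlo whi amX AE n y0 y1 ym lo hi rY = some κ) :
    let dr : ℤ := (regO win wlo whi ym rY ym rY rY ym : ℤ) - regO win wlo whi ym rY ym rY rY amX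
    lo < (3 * ((y0 : ℤ) - 600) + dr) * (3 * ((y0 : ℤ) - 600) + dr) + (3 * ((y0 : ℤ) - 600) + dr) * (3 * ((y1 : ℤ) - 600) + dr) +
        (3 * ((y1 : ℤ) - 600) + dr) * (3 * ((y1 : ℤ) - 600) + dr) + 6 * ((ym : ℤ) - amX) * ((ym : ℤ) - amX) ∧
      (3 * ((y0 : ℤ) - 600) + dr) * (3 * ((y0 : ℤ) - 600) + dr) + (3 * ((y0 : ℤ) - 600) + dr) * (3 * ((y1 : ℤ) - 600) + dr) +
        (3 * ((y1 : ℤ) - 600) + dr) * (3 * ((y1 : ℤ) - 600) + dr) + 6 * ((ym : ℤ) - amX) * ((ym : ℤ) - amX) ≤ hi := by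
  intro dr
  set F := (3 * ((y0 : ℤ) - 600) + dr) * (3 * ((y0 : ℤ) - 600) + dr) + (3 * ((y0 : ℤ) - 600) + dr) * (3 * ((y1 : ℤ) - 600) + dr) +
    (3 * ((y1 : ℤ) - 600) + dr) * (3 * ((y1 : ℤ) - 600) + dr) + 6 * ((ym : ℤ) - amX) * ((ym : ℤ) - amX) with hF
  by_contra hne
  have hor : F ≤ lo ∨ hi < F := by
    rcases not_and_or.mp hne with h1 | h1
    · exact Or.inl (not_lt.mp h1)
    · exact Or.inr (not_le.mp h1)
  have hg : ((F ≤ lo : Bool) || (hi < F : Bool)) = true := by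
    rw [Bool.or_eq_true, decide_eq_true_iff, decide_eq_true_iff]; exact hor
  unfold octx at h
  simp only at h
  rw [hg] at h
  simp at h

/-- the IN-PLANE box from the quadratic form bound alone (any letter difference `|d| ≤ 2`; no layer condition). [folklore] -/
theorem inBoxγ_of_form_le (g0 g1 dm d hi : ℤ) (GB : ℕ) (hd : |d| ≤ 2)
    (h9 : (3 * g0 + d) * (3 * g0 + d) + (3 * g0 + d) * (3 * g1 + d) + (3 * g1 + d) * (3 * g1 + d) + 6 * dm * dm ≤ hi)
    (hGB : 4 * hi < 3 * (3 * (GB : ℤ) + 1) ^ 2) : |g0| ≤ GB ∧ |g1| ≤ GB := by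
  have hnn : 0 ≤ (3 * g0 + d) * (3 * g0 + d) + (3 * g0 + d) * (3 * g1 + d) + (3 * g1 + d) * (3 * g1 + d) + 6 * dm * dm := by
    nlinarith [sq_nonneg (2 * (3 * g0 + d) + (3 * g1 + d)), sq_nonneg (3 * g1 + d), sq_nonneg dm]
  have hhi : 0 ≤ hi := hnn.trans h9
  have hMB' : hi < 6 * (((hi.toNat : ℕ) : ℤ) + 1) ^ 2 := by rw [Int.toNat_of_nonneg hhi]; nlinarith
  obtain ⟨a0, a1, -⟩ := inBox_of_n9_le g0 g1 dm d hi GB hi.toNat hd h9 hGB hMB'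
  exact ⟨a0, a1⟩

/-- a trial letter in range puts the site in the ∃-letter window test. [folklore] -/
theorem someInWindow_of_range {win : List ℕ} {wlo whi amX GB lo hi a b ym rY : ℕ} (hrY : rY ∈ trials (!(inWin wlo whi ym)))
    (hlo : lo < u9O win wlo whi amX GB a b ym rY) (hhi : u9O win wlo whi amX GB a b ym rY ≤ hi) :
    someInWindow win wlo whi amX GB lo hi a b ym = true := by
  unfold someInWindow
  rw [List.any_eq_true]
  refine ⟨rY, hrY, ?_⟩
  simp only [Bool.and_eq_true, Nat.blt_eq, Nat.ble_eq]
  exact ⟨hlo, hhi⟩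

/-! ## §9 completeness of one Δm-block by counting -/

/-- the box offsets `(γ₀ + GB, γ₁ + GB)` of a far code (in-box codes only). -/
def offsO (GB y : ℕ) : ℕ × ℕ := (y / 1442401 + GB - 600, y / 1201 % 1201 + GB - 600)

/-- ★★ COMPLETENESS OF ONE OUT Δm-BLOCK by counting.  An accepted out-slab whose chords all have far layer `ym`, with strictly increasing
far codes and exactly `countWinsO … ym` chords, holds a chord to EVERY far index site `(y0, y1, ym)` whose chord from the base is in the
window `(lo, hi]` under ANY admissible letter assignment `ρ` (window letters fixed, the others arbitrary in `{0,1,2}`). [folklore] -/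
theorem outBlock_complete {win : List ℕ} (hwin : ∀ n ∈ win, n ≤ 2) {wlo whi amX P9 E GB lo hi ym : ℕ} (hX : inWin wlo whi amX = true)
    (hmX : amX < 1201) (hbox : 4 * (hi : ℤ) < 3 * (3 * (GB : ℤ) + 1) ^ 2) {t0 : PT} {cs : List (List ℕ)}
    {T : List (ℕ × ℕ × ℕ)} (hacc : slabAccO win wlo whi amX P9 E lo hi t0 cs = some T) (hstrict : lastCodesStrict cs = true)
    (hfar : farLayer ym cs = true) (hcount : cs.length = countWinsO win wlo whi amX GB lo hi ym)
    {ρ : ℕ → ℕ} (hρ : AdmO win wlo whi ρ) {y0 y1 : ℕ}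
    (hlo : (lo : ℤ) < n9Z (vecL ρ (chordXO amX, (y0, y1, ym)))) (hhi : n9Z (vecL ρ (chordXO amX, (y0, y1, ym))) ≤ hi) :
    ∃ c ∈ cs, dec3 (lastD c 0) = (y0, y1, ym) := by
  classical
  have hym := farLayer_sound hfar
  set P : Finset (ℕ × ℕ) := ((boxPairs GB).filter fun ab => someInWindow win wlo whi amX GB lo hi ab.1 ab.2 ym).toFinset with hP
  -- (1) every chord: far site in the box and its offsets in `P`
  have hin : ∀ y ∈ cs.map (fun c => lastD c 0), (600 ≤ y / 1442401 + GB ∧ y / 1442401 ≤ 600 + GB ∧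
      600 ≤ y / 1201 % 1201 + GB ∧ y / 1201 % 1201 ≤ 600 + GB) ∧ offsO GB y ∈ P := by
    intro y hy
    obtain ⟨c, hc, rfl⟩ := List.mem_map.mp hy
    obtain ⟨u, u', hu⟩ := slabAccO_accepted hacc c hc
    obtain ⟨rY, hrY, κ, hoc⟩ := addChordO_witness hu
    rw [hym c hc] at hrY hoc
    obtain ⟨h1, h2⟩ := octx_some_range hoc
    have hrY2 := le_two_of_mem_trials hrY
    have hra := regO_le_two hwin hrY2 hrY2 hrY2 (wlo := wlo) (whi := whi) (amY := ym) (amA := ym) amX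
    have hrb := regO_le_two hwin hrY2 hrY2 hrY2 (wlo := wlo) (whi := whi) (amY := ym) (amA := ym) ym
    have hd : |((regO win wlo whi ym rY ym rY rY ym : ℕ) : ℤ) - regO win wlo whi ym rY ym rY rY amX| ≤ 2 := by
      rw [abs_le]; constructor <;> omega
    obtain ⟨hg0, hg1⟩ := inBoxγ_of_form_le _ _ _ _ _ GB hd h2 hbox
    rw [abs_le] at hg0 hg1
    have hb : 600 ≤ lastD c 0 / 1442401 + GB ∧ lastD c 0 / 1442401 ≤ 600 + GB ∧
        600 ≤ lastD c 0 / 1201 % 1201 + GB ∧ lastD c 0 / 1201 % 1201 ≤ 600 + GB := by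
      refine ⟨?_, ?_, ?_, ?_⟩ <;> push_cast at hg0 hg1 <;> omega
    refine ⟨hb, ?_⟩
    rw [hP, List.mem_toFinset, List.mem_filter]
    refine ⟨mem_boxPairs.mpr ⟨by omega, by omega⟩, ?_⟩
    have hu9 := u9O_eq win wlo whi amX GB (lastD c 0 / 1442401 + GB - 600) (lastD c 0 / 1201 % 1201 + GB - 600) ym rY hmX hra
    have e0 : (((lastD c 0 / 1442401 + GB - 600 : ℕ) : ℤ) - GB) = ((lastD c 0 / 1442401 : ℕ) : ℤ) - 600 := by
      rw [Nat.cast_sub hb.1]; push_cast; ring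
    have e1 : (((lastD c 0 / 1201 % 1201 + GB - 600 : ℕ) : ℤ) - GB) = ((lastD c 0 / 1201 % 1201 : ℕ) : ℤ) - 600 := by
      rw [Nat.cast_sub hb.2.2.1]; push_cast; ring
    simp only at hu9
    rw [e0, e1] at hu9
    refine someInWindow_of_range hrY ?_ ?_
    · have : (lo : ℤ) < (u9O win wlo whi amX GB (lastD c 0 / 1442401 + GB - 600) (lastD c 0 / 1201 % 1201 + GB - 600) ym rY : ℤ) := by
        rw [hu9]; exact h1
      exact_mod_cast this
    · have : (u9O win wlo whi amX GB (lastD c 0 / 1442401 + GB - 600) (lastD c 0 / 1201 % 1201 + GB - 600) ym rY : ℤ) ≤ hi := by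
        rw [hu9]; exact h2
      exact_mod_cast this
  -- (2) the offsets of distinct far codes of the block are distinct
  have hnd : ((cs.map fun c => lastD c 0).map (offsO GB)).Nodup := by
    refine (nodup_lastCodes_of_strict hstrict).map_on fun y hy y' hy' heq => ?_
    obtain ⟨hb, -⟩ := hin y hy
    obtain ⟨hb', -⟩ := hin y' hy'
    obtain ⟨c, hc, rfl⟩ := List.mem_map.mp hy
    obtain ⟨c', hc', rfl⟩ := List.mem_map.mp hy'
    have hm := hym c hc
    have hm' := hym c' hc'
    simp only [offsO, Prod.mk.injEq] at heq
    apply dec3_inj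
    simp only [dec3, Prod.mk.injEq]
    omega
  -- (3) the pigeonhole currency
  have hcard : P.card ≤ (cs.map fun c => lastD c 0).length := by
    rw [List.length_map, hcount, hP]; exact card_filter_boxPairs_le win wlo whi amX GB lo hi ym
  -- (4) the target's offsets lie in `P`
  have h2ρ := hρ.2
  have hdρ : |((ρ ym : ℕ) : ℤ) - ρ amX| ≤ 2 := by
    have := h2ρ ym; have := h2ρ amX; rw [abs_le]; constructor <;> omega
  have hform : n9Z (vecL ρ (chordXO amX, (y0, y1, ym))) =
      (3 * ((y0 : ℤ) - 600) + ((ρ ym : ℤ) - ρ amX)) * (3 * ((y0 : ℤ) - 600) + ((ρ ym : ℤ) - ρ amX)) +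
      (3 * ((y0 : ℤ) - 600) + ((ρ ym : ℤ) - ρ amX)) * (3 * ((y1 : ℤ) - 600) + ((ρ ym : ℤ) - ρ amX)) +
      (3 * ((y1 : ℤ) - 600) + ((ρ ym : ℤ) - ρ amX)) * (3 * ((y1 : ℤ) - 600) + ((ρ ym : ℤ) - ρ amX)) +
      6 * ((ym : ℤ) - amX) * ((ym : ℤ) - amX) := by
    simp only [n9Z, vecL, chordXO]; push_cast; ring
  rw [hform] at hlo hhi
  obtain ⟨hg0, hg1⟩ := inBoxγ_of_form_le _ _ _ _ _ GB hdρ hhi hbox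
  rw [abs_le] at hg0 hg1
  have hb : 600 ≤ y0 + GB ∧ y0 ≤ 600 + GB ∧ 600 ≤ y1 + GB ∧ y1 ≤ 600 + GB := by
    refine ⟨?_, ?_, ?_, ?_⟩ <;> omega
  set rY := (bif inWin wlo whi ym then 0 else ρ ym) with hrYdef
  have hrYmem : rY ∈ trials (!(inWin wlo whi ym)) := by
    rw [hrYdef]; unfold trials
    cases inWin wlo whi ym
    · have := h2ρ ym
      simp only [cond_false, Bool.not_false, cond_true, List.mem_cons, List.not_mem_nil, or_false]
      omega
    · simp
  have hrX : regO win wlo whi ym rY ym rY rY amX = ρ amX := by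
    unfold regO; rw [hX]; simp only [cond_true]; exact (hρ.1 amX hX).symm
  have hrYv : regO win wlo whi ym rY ym rY rY ym = ρ ym := by
    rw [hrYdef]; unfold regO
    cases hw : inWin wlo whi ym
    · simp only [cond_false, Nat.beq_refl, cond_true]
    · simp only [cond_true]; exact (hρ.1 ym hw).symm
  have hra : regO win wlo whi ym rY ym rY rY amX ≤ 2 := by rw [hrX]; exact h2ρ amX
  have hu9 := u9O_eq win wlo whi amX GB (y0 + GB - 600) (y1 + GB - 600) ym rY hmX hra
  have e0 : (((y0 + GB - 600 : ℕ) : ℤ) - GB) = (y0 : ℤ) - 600 := by rw [Nat.cast_sub hb.1]; push_cast; ring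
  have e1 : (((y1 + GB - 600 : ℕ) : ℤ) - GB) = (y1 : ℤ) - 600 := by rw [Nat.cast_sub hb.2.2.1]; push_cast; ring
  simp only at hu9
  rw [e0, e1, hrX, hrYv] at hu9
  have hsP : (y0 + GB - 600, y1 + GB - 600) ∈ P := by
    rw [hP, List.mem_toFinset, List.mem_filter]
    refine ⟨mem_boxPairs.mpr ⟨by omega, by omega⟩, someInWindow_of_range hrYmem ?_ ?_⟩
    · have : (lo : ℤ) < (u9O win wlo whi amX GB (y0 + GB - 600) (y1 + GB - 600) ym rY : ℤ) := by rw [hu9]; exact hlo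
      exact_mod_cast this
    · have : (u9O win wlo whi amX GB (y0 + GB - 600) (y1 + GB - 600) ym rY : ℤ) ≤ hi := by rw [hu9]; exact hhi
      exact_mod_cast this
  -- (5) count
  obtain ⟨y, hy, hyo⟩ := cover_of_card_le_map (cs.map fun c => lastD c 0) (offsO GB) P hnd (fun y hy => (hin y hy).2) hcard _ hsP
  obtain ⟨hby, -⟩ := hin y hy
  obtain ⟨c, hc, rfl⟩ := List.mem_map.mp hy
  refine ⟨c, hc, ?_⟩
  have hm := hym c hc
  simp only [offsO, Prod.mk.injEq] at hyo
  simp only [dec3, Prod.mk.injEq]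
  omega

end Summit.AtomisticToContinuum.Crystallization.Theorems.ChartedZeroExcessLayeredLatticeLiouville.ThetaKernel
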